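import Summits.Ventures.PercRepro.Night2ThreeTwoTypeLoss

/-!
# PercRepro — the cell `(3, 2)`: the non-`P` mass of a target with the type-split per-basis bounds (night-2, gen 26)

`pi2MassH_le_lineCount` charges every covering basis of a target the same bound `E`.  Splitting the covering bases of a
target by their number of points on the common line `ℓ` (`2`, `1` or `0` — an independent set meets a rank-`2` set in at
most two points) and charging each class its own bound gives the mass bound
`(C(i,2) C(j,2) E₂ + i C(j,3) E₁ + C(j,4) E₀)/(2^{n−4} − 1)`, `(i, j) = (|(S ∖ K) ∩ ℓ|, |(S ∖ K) ∖ ℓ|)`.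

* `mass3`: the type-split mass `C(i,2) C(j,2) E₂ + i C(j,3) E₁ + C(j,4) E₀`;
* `pi2MassH_le_sum_coverBases`: the mass through the covering bases (the first half of `pi2MassH_le_coverBases`);
* **`pi2MassH_le_mass3`**: the type-split mass bound.
-/

namespace PercRepro.Shadow

open Finset PerFlat ThmH

variable {α : Type*} [DecidableEq α] {M : Matroid α} [M.Finite]

section TypeMass

variable {G : Finset α}

/-- The type-split mass `C(i,2) C(j,2) E₂ + i C(j,3) E₁ + C(j,4) E₀` of a target of profile `(i, j)`. -/
def mass3 (E₂ E₁ E₀ : ℚ) (i j : ℕ) : ℚ :=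
  (i.choose 2 * j.choose 2 : ℚ) * E₂ + (i * j.choose 3 : ℚ) * E₁ + (j.choose 4 : ℚ) * E₀

omit [DecidableEq α] [M.Finite] in
/-- The mass is nonnegative for nonnegative constants. -/
theorem mass3_nonneg {E₂ E₁ E₀ : ℚ} (h2 : 0 ≤ E₂) (h1 : 0 ≤ E₁) (h0 : 0 ≤ E₀) (i j : ℕ) :
    0 ≤ mass3 E₂ E₁ E₀ i j := by
  unfold mass3; positivity

open scoped Classical in
/-- **The non-`P` loss mass of a target through its covering bases**: `pi2MassH S ≤ Σ_{T ∈ coverBases} Σ_w faceLoss (K ∪ T) w / D`. -/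
theorem pi2MassH_le_sum_coverBases {q d ρ : ℕ} (hG : G ∈ flatsQ M (q + 1)) (hd : (gr M \ G).card = d) (hdq : d ≤ q)
    (hk : kColoops M G + ρ = q + 1) {P : Finset α → Prop} [DecidablePred P]
    (hP : ∀ B ∈ thinMembers M q G, ¬ P B → (B \ coloops M G).card + 1 = ρ) (S : Finset α) :
    pi2MassH M q G P S ≤
      ∑ T ∈ coverBases M G S ρ, (∑ w ∈ T, faceLoss M q G (coloops M G ∪ T) w) /
        ((2 ^ ((G.card - kColoops M G) - ρ) - 1 : ℕ) : ℚ) := by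
  have hd' : (gr M \ G).card ≤ q := by omega
  set r := (G.card - kColoops M G) - ρ with hr
  set D : ℚ := ((2 ^ r - 1 : ℕ) : ℚ) with hD
  have hD0 : 0 ≤ D := by rw [hD]; positivity
  set F := ((thinMembers M q G).filter (fun B => ¬ P B)).sigma
    (fun B => (G \ clF M B).filter (fun z => S ∈ tgtSets M q G B z)) with hF
  have hsum : pi2MassH M q G P S = ∑ x ∈ F, rhoL M q G x.1 x.2 := by
    unfold pi2MassH
    rw [hF, Finset.sum_sigma]
    apply Finset.sum_congr rfl
    intro B _
    rw [Finset.sum_filter]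
  rw [hsum]
  set g : (Σ _T : Finset α, α) → ℚ := fun x => faceLoss M q G (coloops M G ∪ x.1) x.2 / D with hg
  set φ : (Σ _B : Finset α, α) → (Σ _T : Finset α, α) := fun x => ⟨insert x.2 (x.1 \ coloops M G), x.2⟩ with hφ
  have hmem : ∀ x ∈ F, x.1 ∈ thinMembers M q G ∧ x.2 ∈ G \ clF M x.1 ∧ S ∈ tgtSets M q G x.1 x.2 ∧
      (x.1 \ coloops M G).card + 1 = ρ := by
    intro x hx
    rw [hF, Finset.mem_sigma, Finset.mem_filter, Finset.mem_filter] at hx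
    exact ⟨hx.1.1, hx.2.1, hx.2.2, hP x.1 hx.1.1 hx.1.2⟩
  have hQ : ∀ x ∈ F, coloops M G ∪ insert x.2 (x.1 \ coloops M G) = insert x.2 x.1 := by
    intro x hx
    obtain ⟨hB, -, -, -⟩ := hmem x hx
    have hK : coloops M G ⊆ x.1 := coloops_subset_of_mem_thinMembers hG hd' hB
    ext y
    simp only [Finset.mem_union, Finset.mem_insert, Finset.mem_sdiff]
    constructor
    · rintro (h | h | ⟨h, -⟩)
      · exact Or.inr (hK h)
      · exact Or.inl h
      · exact Or.inr h
    · rintro (h | h)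
      · exact Or.inr (Or.inl h)
      · by_cases hy : y ∈ coloops M G
        · exact Or.inl hy
        · exact Or.inr (Or.inr ⟨h, hy⟩)
  have hval : ∀ x ∈ F, rhoL M q G x.1 x.2 = g (φ x) := by
    intro x hx
    obtain ⟨hB, hz, -, h2⟩ := hmem x hx
    have hB' : x.1 ∈ membersIn M (Uq M (q + 2) q) G := (mem_thinMembers.1 hB).1
    have hBU : x.1 ∈ Uq M (q + 2) q := (mem_membersIn.1 hB').1
    have hzB : x.2 ∉ x.1 := notMem_of_notMem_clF hBU (Finset.mem_sdiff.1 hz).2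
    simp only [hg, hφ]
    rw [hQ x hx]
    unfold rhoL faceLoss
    rw [Finset.erase_insert hzB, if_pos ⟨hB, hz⟩, card_tgtSets hG hB' hz,
      card_sdiff_insert_eq_dqm1 hG hd' hB h2 hz, ← hr]
  have hinj : Set.InjOn φ (F : Set (Σ _B : Finset α, α)) := by
    intro x hx x' hx' heq
    rw [Finset.mem_coe] at hx hx'
    obtain ⟨hB, hz, -, -⟩ := hmem x hx
    obtain ⟨hB', hz', -, -⟩ := hmem x' hx'
    simp only [hφ, Sigma.mk.injEq] at heq
    obtain ⟨hT, hzz⟩ := heq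
    have hzz' : x.2 = x'.2 := eq_of_heq hzz
    have hBU : x.1 ∈ Uq M (q + 2) q := (mem_membersIn.1 (mem_thinMembers.1 hB).1).1
    have hBU' : x'.1 ∈ Uq M (q + 2) q := (mem_membersIn.1 (mem_thinMembers.1 hB').1).1
    have hBB := lossPairs_inj hG hd' hB hB' hT hzz'
      (notMem_of_notMem_clF hBU (Finset.mem_sdiff.1 hz).2)
      (notMem_of_notMem_clF hBU' (Finset.mem_sdiff.1 hz').2)
    exact Sigma.ext hBB (heq_of_eq hzz')
  have himg : Finset.image φ F ⊆ (coverBases M G S ρ).sigma (fun T => T) := by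
    intro y hy
    rw [Finset.mem_image] at hy
    obtain ⟨x, hx, rfl⟩ := hy
    obtain ⟨hB, hz, hxS, h2⟩ := hmem x hx
    have hB' : x.1 ∈ membersIn M (Uq M (q + 2) q) G := (mem_thinMembers.1 hB).1
    have hBU : x.1 ∈ Uq M (q + 2) q := (mem_membersIn.1 hB').1
    have hzB : x.2 ∉ x.1 := notMem_of_notMem_clF hBU (Finset.mem_sdiff.1 hz).2
    have hzK : x.2 ∉ x.1 \ coloops M G := fun hh => hzB (Finset.mem_sdiff.1 hh).1
    have hsub : insert x.2 x.1 ⊆ S := (mem_tgtSets.1 hxS).2.1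
    have hK : coloops M G ⊆ x.1 := coloops_subset_of_mem_thinMembers hG hd' hB
    have hcard : (insert x.2 x.1 \ coloops M G).card = ρ := by
      have : insert x.2 x.1 \ coloops M G = insert x.2 (x.1 \ coloops M G) := by
        ext y
        simp only [Finset.mem_sdiff, Finset.mem_insert]
        constructor
        · rintro ⟨h | h, hy⟩
          · exact Or.inl h
          · exact Or.inr ⟨h, hy⟩
        · rintro (rfl | ⟨h, hy⟩)
          · exact ⟨Or.inl rfl, fun hc => hzB (hK hc)⟩
          · exact ⟨Or.inr h, hy⟩
      rw [this, Finset.card_insert_of_notMem hzK, h2]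
    have hind : M.Indep ((coloops M G ∪ insert x.2 (x.1 \ coloops M G) : Finset α) : Set α) := by
      rw [hQ x hx]
      exact indep_of_mem_shadowAt_card hk (insert_mem_shadowAt_thin hG hB hz) hcard
    simp only [hφ]
    rw [Finset.mem_sigma]
    refine ⟨?_, Finset.mem_insert_self _ _⟩
    unfold coverBases
    rw [Finset.mem_filter, Finset.mem_powersetCard]
    refine ⟨⟨?_, ?_⟩, hind⟩
    · intro y hy
      rw [Finset.mem_insert] at hy
      rw [Finset.mem_sdiff]
      rcases hy with rfl | hy
      · exact ⟨hsub (Finset.mem_insert_self _ _), fun hzc => hzB (hK hzc)⟩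
      · rw [Finset.mem_sdiff] at hy
        exact ⟨hsub (Finset.mem_insert_of_mem hy.1), hy.2⟩
    · rw [Finset.card_insert_of_notMem hzK, h2]
  have hg0 : ∀ y, 0 ≤ g y := fun y => div_nonneg (faceLoss_nonneg hG hd' _ _) hD0
  calc ∑ x ∈ F, rhoL M q G x.1 x.2 = ∑ x ∈ F, g (φ x) := Finset.sum_congr rfl hval
    _ = ∑ y ∈ Finset.image φ F, g y := (Finset.sum_image hinj).symm
    _ ≤ ∑ y ∈ (coverBases M G S ρ).sigma (fun T => T), g y :=
        Finset.sum_le_sum_of_subset_of_nonneg himg (fun y _ _ => hg0 y)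
    _ = ∑ T ∈ coverBases M G S ρ, (∑ w ∈ T, faceLoss M q G (coloops M G ∪ T) w) / D := by
        rw [Finset.sum_sigma]
        apply Finset.sum_congr rfl
        intro T _
        rw [Finset.sum_div]

open scoped Classical in
/-- The covering bases of `S` with exactly `k` points on `ℓ` number at most `C(i, k) · C(j, 4 − k)`. -/
theorem card_coverBases_filter_le (S ℓ : Finset α) (k : ℕ) :
    ((coverBases M G S 4).filter (fun T => (T ∩ ℓ).card = k)).card ≤
      ((S \ coloops M G) ∩ ℓ).card.choose k * ((S \ coloops M G) \ ℓ).card.choose (4 - k) := by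
  have hsub : (coverBases M G S 4).filter (fun T => (T ∩ ℓ).card = k) ⊆
      ((S \ coloops M G).powersetCard 4).filter (fun T => (T ∩ ((S \ coloops M G) ∩ ℓ)).card = k) := by
    intro T hT
    rw [Finset.mem_filter] at hT
    obtain ⟨hT1, hT2⟩ := hT
    unfold coverBases at hT1
    rw [Finset.mem_filter] at hT1
    rw [Finset.mem_filter]
    refine ⟨hT1.1, ?_⟩
    have hTS : T ⊆ S \ coloops M G := (Finset.mem_powersetCard.1 hT1.1).1
    have : T ∩ ((S \ coloops M G) ∩ ℓ) = T ∩ ℓ := by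
      ext a
      simp only [Finset.mem_inter]
      exact ⟨fun h => ⟨h.1, h.2.2⟩, fun h => ⟨h.1, hTS h.1, h.2⟩⟩
    rw [this]
    exact hT2
  have := (Finset.card_le_card hsub).trans
    (card_filter_inter_card_eq_le (S \ coloops M G) ((S \ coloops M G) ∩ ℓ) k)
  have he : (S \ coloops M G) \ ((S \ coloops M G) ∩ ℓ) = (S \ coloops M G) \ ℓ := by
    ext a
    simp only [Finset.mem_sdiff, Finset.mem_inter]
    tauto
  rwa [he] at this

open scoped Classical in
/-- **THE TYPE-SPLIT MASS BOUND** (cell `(3, 2)`, `P ⊇` the big members): with `ℓ` of rank `≤ 2` and the face losses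
of the covering bases of `S` with `2` / `1` / `0` points on `ℓ` summing to at most `E₂` / `E₁` / `E₀`,
`pi2MassH S ≤ mass3 E₂ E₁ E₀ i j / (2^{n−4} − 1)`, `i = |(S ∖ K) ∩ ℓ|`, `j = |(S ∖ K) ∖ ℓ|`. -/
theorem pi2MassH_le_mass3 (hG : G ∈ flatsQ M (5 + 1)) (hd : (gr M \ G).card = 3) (hk : kColoops M G = 2)
    {P : Finset α → Prop} [DecidablePred P] (hP : ∀ B, 4 ≤ (B \ coloops M G).card → P B)
    {E₂ E₁ E₀ : ℚ} (h2 : 0 ≤ E₂) (h1 : 0 ≤ E₁) (h0 : 0 ≤ E₀) (S ℓ : Finset α) (hℓ : rkN M ℓ ≤ 2)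
    (hTE2 : ∀ T ∈ coverBases M G S 4, (T ∩ ℓ).card = 2 → ∑ w ∈ T, faceLoss M 5 G (coloops M G ∪ T) w ≤ E₂)
    (hTE1 : ∀ T ∈ coverBases M G S 4, (T ∩ ℓ).card = 1 → ∑ w ∈ T, faceLoss M 5 G (coloops M G ∪ T) w ≤ E₁)
    (hTE0 : ∀ T ∈ coverBases M G S 4, (T ∩ ℓ).card = 0 → ∑ w ∈ T, faceLoss M 5 G (coloops M G ∪ T) w ≤ E₀) :
    pi2MassH M 5 G P S ≤
      mass3 E₂ E₁ E₀ ((S \ coloops M G) ∩ ℓ).card ((S \ coloops M G) \ ℓ).card /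
        ((2 ^ ((G.card - kColoops M G) - 4) - 1 : ℕ) : ℚ) := by
  have hd' : (gr M \ G).card ≤ 5 := by omega
  have hk' : kColoops M G + 4 = 5 + 1 := by omega
  have hP' : ∀ B ∈ thinMembers M 5 G, ¬ P B → (B \ coloops M G).card + 1 = 4 := by
    intro B hB hnP
    have h3 := card_sdiff_coloops_thin_ge hG hd' hk' hB
    by_contra h
    exact hnP (hP B (by omega))
  set D : ℚ := ((2 ^ ((G.card - kColoops M G) - 4) - 1 : ℕ) : ℚ) with hD
  have hD0 : 0 ≤ D := by rw [hD]; positivity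
  set g : Finset α → ℚ := fun T => ∑ w ∈ T, faceLoss M 5 G (coloops M G ∪ T) w with hg
  have hg0 : ∀ T, 0 ≤ g T := fun T => Finset.sum_nonneg (fun w _ => faceLoss_nonneg hG hd' _ _)
  refine (pi2MassH_le_sum_coverBases hG hd (by norm_num) hk' hP' S).trans ?_
  rw [← Finset.sum_div]
  apply div_le_div_of_nonneg_right _ hD0
  -- split the covering bases by their number of points on the line
  have hmaps : ∀ T ∈ coverBases M G S 4, (T ∩ ℓ).card ∈ Finset.range 3 := by
    intro T hT
    unfold coverBases at hT
    rw [Finset.mem_filter] at hT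
    have hTI : M.Indep (T : Set α) := hT.2.subset (by exact_mod_cast Finset.subset_union_right)
    rw [Finset.mem_range]
    have := card_inter_le_two_of_indep hTI hℓ
    omega
  rw [← Finset.sum_fiberwise_of_maps_to hmaps]
  rw [Finset.sum_range_succ, Finset.sum_range_succ, Finset.sum_range_succ, Finset.sum_range_zero, zero_add]
  have hbound : ∀ k : ℕ, ∀ E : ℚ, (∀ T ∈ coverBases M G S 4, (T ∩ ℓ).card = k → g T ≤ E) → 0 ≤ E →
      ∑ T ∈ (coverBases M G S 4).filter (fun T => (T ∩ ℓ).card = k), g T ≤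
        (((S \ coloops M G) ∩ ℓ).card.choose k * ((S \ coloops M G) \ ℓ).card.choose (4 - k) : ℚ) * E := by
    intro k E hE hE0
    calc ∑ T ∈ (coverBases M G S 4).filter (fun T => (T ∩ ℓ).card = k), g T
        ≤ ∑ _T ∈ (coverBases M G S 4).filter (fun T => (T ∩ ℓ).card = k), E := by
          apply Finset.sum_le_sum
          intro T hT
          rw [Finset.mem_filter] at hT
          exact hE T hT.1 hT.2
      _ = (((coverBases M G S 4).filter (fun T => (T ∩ ℓ).card = k)).card : ℚ) * E := by
          rw [Finset.sum_const, nsmul_eq_mul]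
      _ ≤ (((S \ coloops M G) ∩ ℓ).card.choose k * ((S \ coloops M G) \ ℓ).card.choose (4 - k) : ℚ) * E := by
          apply mul_le_mul_of_nonneg_right _ hE0
          exact_mod_cast card_coverBases_filter_le S ℓ k
  have hb0 := hbound 0 E₀ hTE0 h0
  have hb1 := hbound 1 E₁ hTE1 h1
  have hb2 := hbound 2 E₂ hTE2 h2
  simp only [Nat.choose_zero_right, Nat.choose_one_right, Nat.sub_zero, Nat.cast_one, one_mul] at hb0 hb1
  unfold mass3
  push_cast at hb0 hb1 hb2 ⊢
  linarith

end TypeMass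

end PercRepro.Shadow
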